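import Summits.HubbardSuperconductivity.HubbardSuperconductivity.Theses.ThermalWedge
import Summits.HubbardSuperconductivity.HubbardSuperconductivity.Theorems.TwSeededEnsembleEquivalence.Negative.ObstructionTemplates
import Summits.HubbardSuperconductivity.HubbardSuperconductivity.Theorems.TwSeededEnsembleEquivalence.Negative.SeedLeverage
import Literature.MathematicalPhysics.QuantumLattice.LiebFluxPhaseProofs
import Literature.MathematicalPhysics.QuantumLattice.DWaveSourceProofs
import Literature.MathematicalPhysics.QuantumLattice.DWaveSourceFreePressure
import Literature.MathematicalPhysics.QuantumLattice.DuhamelTwoPoint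
import Summits.HubbardSuperconductivity.HubbardSuperconductivity.Theorems.ThermalWedgeTwSeededEnsembleEquivalenceGroundSectorExists
import Summits.HubbardSuperconductivity.HubbardSuperconductivity.Theorems.ThermalWedgeTwSeededEnsembleEquivalencePairFieldSinglet
import Summits.HubbardSuperconductivity.HubbardSuperconductivity.Theorems.ThermalWedgeTwSeededEnsembleEquivalenceEvenSectorMin
import Summits.HubbardSuperconductivity.HubbardSuperconductivity.Theorems.ThermalWedgeTwSeededEnsembleEquivalenceSeedCommutator
import Summits.HubbardSuperconductivity.HubbardSuperconductivity.Theorems.ThermalWedgeTwSeededEnsembleEquivalenceOneParticleCost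
import Summits.HubbardSuperconductivity.HubbardSuperconductivity.Theorems.ThermalWedgeTwSeededEnsembleEquivalenceCloser
import Summits.HubbardSuperconductivity.HubbardSuperconductivity.Theorems.ThermalWedgeTwSeededEnsembleEquivalenceCloserSecant

/-!
# Crux `TwSeededEnsembleEquivalence` (stmt-HubbardSuperconductivity-1698) — line `exposed-density-duality`

SKELETON v5 (line lead gen 1, 2026-08-16). Seven of the eight v3 stubs have LANDED as `--supports` files and are imported
(`stub_groundSectorExists` p75245, `stub_pairFieldSinglet` p74713, `stub_evenSectorMin` p74791, `stub_seedCommutator` p75238,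
`stub_oneParticleCost` p75021, `stub_closer` p75364, `stub_closerSecant` p76106); v3 REPLACED the transfer by its weaker finite-volume form `stub_secantBracketT0`
(+ the matching closer `stub_closerSecant`, landed as `…CloserSecant`); v4 imported it; v5 RESHAPES the transfer `stub_secantBracketT0` (now a proved
composition `secantBracketT0_of_stubs`) into the T = 0 approximating-Hamiltonian bound for the seeded torus
(`stub_t0AHM`, infrastructure, provable now from the tree's Bogoliubov Jr. estimate) and the secant bracket of the
finite-volume T = 0 BOGOLIUBOV FUNCTIONAL `B_L(μ) = inf_h [E₀(dWaveSourceTorus L U μ h) + h²L²/g]`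
(`stub_sourcedSecantBracketT0`, the physics input, now a statement about the SHORT-RANGE sourced torus only); the
thermodynamic-limit form (exposed density at T = 0) still closes the crux via the landed `stub_closer`
(`TwSeededEnsembleEquivalence_of_exposedDensityT0`, hypothesis explicit). The crux of route `ThermalWedge`,

  ∀ δ ∈ [1/10,2/5] ∃ −4<μ₁≤μ₂<0 ∃ U₀>0 ∀ U∈(0,U₀] ∀ g∈(0,1/10] ∀ β≥1 ∃ μ∈[μ₁,μ₂] ∀ ε>0, eventually in L:
      e_L(g) + p_L(β,μ,g) − μ n_L ≤ log 4/β + ε,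

is reduced to ONE transfer statement `stub_secantBracketT0` (finite-volume secant bracket of the
grand-canonical ground energy at an `L`-independent `μ₀` of the `δ`-window: no first-order density
jump of the seeded model across `1 − δ` at `T = 0`) plus finite-dimensional bookkeeping stubs, composed as

  HullTouch (β-free)  ⟹  crux                       (`hullTouch_implies_crux`, proved here:
                                                     `Re Z ≤ 4^{L²} e^{−βE₀}`),
  exposed density + ground sector + even-sector SU(2) bookkeeping + T = 0 one-particle cost
                      ⟹  HullTouch                  (`stub_closer`, held by the lead: kink lemma
                                                     brackets every GC ground sector within ηL²
                                                     of N_L, then walk ≤ ηL²+2 one-particle steps).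

Notation (all terms are literal tree terms; no definitions are introduced):
`P_L = (pairField dWaveFormFactor L)ᴴ(pairField dWaveFormFactor L)`,
`Hcan = hubbardTorus 2 L 1 U − (g/L²)P_L`, `Hgc μ = hubbardTorusWith 2 L 1 U μ − (g/L²)P_L = Hcan − μN̂`,
`E_N = Hcan.minEnergyOn (nParticleSubmodule N)`, `N_L = 2⌊(1−δ)L²/2⌋₊`.
-/

namespace Summit.HubbardSuperconductivity.HubbardSuperconductivity.Theorems.TwSeededEnsembleEquivalence.ExposedDensity

open Matrix Filter Topology Literature.MathematicalPhysics.QuantumLattice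
open Summit.HubbardSuperconductivity.HubbardSuperconductivity.Theses.ThermalWedge
open Summit.HubbardSuperconductivity.HubbardSuperconductivity.Theorems.TwSeededEnsembleEquivalence.Negative
open scoped ComplexOrder Matrix.Norms.L2Operator

noncomputable section

/-! ## Stubs -/

-- `stub_groundSectorExists` LANDED at p75245 (module `…Theorems.ThermalWedgeTwSeededEnsembleEquivalenceGroundSectorExists`, imported above).

-- `stub_pairFieldSinglet` LANDED at p74713 (module `…Theorems.ThermalWedgeTwSeededEnsembleEquivalencePairFieldSinglet`, imported above).

-- `stub_evenSectorMin` LANDED at p74791 (module `…Theorems.ThermalWedgeTwSeededEnsembleEquivalenceEvenSectorMin`, imported above).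

-- `stub_seedCommutator` LANDED at p75238 (module `…Theorems.ThermalWedgeTwSeededEnsembleEquivalenceSeedCommutator`, imported above).

-- `stub_oneParticleCost` LANDED at p75021 (module `…Theorems.ThermalWedgeTwSeededEnsembleEquivalenceOneParticleCost`, imported above).

/-- STUB (infrastructure, provable now) — **T = 0 APPROXIMATING-HAMILTONIAN BOUND FOR THE SEEDED TORUS**,
both halves, uniformly in the chemical potential on compacts. With `Hgc_L(μ) = hubbardTorusWith 2 L 1 U μ − (g/L²)Δ_dᴴΔ_d`
and the sourced SHORT-RANGE Hamiltonian `S_L(μ,h) = dWaveSourceTorus L U μ h = hubbardTorusWith − h(Δ_d + Δ_dᴴ)`: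
(easy half, every `L, μ, h`) `E₀(Hgc_L(μ)) ≤ E₀(S_L(μ,h)) + h²L²/g` — the completed square
`−(g/L²)ΔᴴΔ ≤ −h(Δ+Δᴴ) + (h²L²/g)·1`, i.e. the tree's `log_partitionFn_approx_le_model` at `c = h/√g`, then `β → ∞`;
(hard half) `∀ ε ∃ L₀ ∀ L ≥ L₀ ∀ |μ| ≤ M ∃ h ≥ 0: E₀(S_L(μ,h)) + h²L²/g ≤ E₀(Hgc_L(μ)) + εL²` — the tree's quantitative
Bogoliubov Jr. estimate `exists_pressure_model_le` at `W = √g Δ_d`, `V = L²`, with the locality constants of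
`Theorems/ThermalWedgeTwApproximatingHamiltonianLocality` (‖[Δ,Δᴴ]‖, ‖[T_μ,Δ]‖ = O(L²), uniform for |μ| ≤ M) and the
trivial double-commutator bounds (error `4rC₁ + C(r,M)/L`, UNIFORM in `β ≥ 1` because `2C₁/(βr) ≤ 2C₁/r`), the gauge
rotation `twAhm_partitionFn_approx_eq_dWaveSourceTorus` making the amplitude real, and `β := log 4/(εL²)`-large in the
sandwich `−βE₀ ≤ log Z_β ≤ L² log 4 − βE₀` (`Negative/BetaMonotonicity`) to pass from pressures to ground energies at
FIXED `L` (no compactness needed). Bogolyubov Jr.–Brankov–Zagrebnov–Kurbatov–Tonchev 1984; Bru–de Siqueira Pedra 2013,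
Thm 107; the thermal instance is the landed `twApproximatingHamiltonian_proof` (item 1703). -/
theorem stub_t0AHM :
    ∀ (U g M : ℝ), 0 < g →
      (∀ (L : ℕ) [NeZero L] (μ h : ℝ),
        (hubbardTorusWith 2 L 1 U μ - ((g / (L : ℝ) ^ 2 : ℝ) : ℂ) •
            ((pairField dWaveFormFactor L)ᴴ * pairField dWaveFormFactor L)).groundEnergy ≤
          (dWaveSourceTorus L U μ h).groundEnergy + h ^ 2 * (L : ℝ) ^ 2 / g) ∧
      (∀ ε : ℝ, 0 < ε → ∃ L₀ : ℕ, ∀ (L : ℕ) [NeZero L], L₀ ≤ L → ∀ μ : ℝ, |μ| ≤ M →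
        ∃ h : ℝ, 0 ≤ h ∧
          (dWaveSourceTorus L U μ h).groundEnergy + h ^ 2 * (L : ℝ) ^ 2 / g ≤
            (hubbardTorusWith 2 L 1 U μ - ((g / (L : ℝ) ^ 2 : ℝ) : ℂ) •
              ((pairField dWaveFormFactor L)ᴴ * pairField dWaveFormFactor L)).groundEnergy +
              ε * (L : ℝ) ^ 2) := by
  sorry

/-- STUB — THE TRANSFER `C⁺` (the crux's content, now on the SOURCED SHORT-RANGE MODEL ONLY): **SECANT BRACKET AT
`T = 0` OF THE FINITE-VOLUME BOGOLIUBOV FUNCTIONAL** `B_L(μ) := inf_{h ∈ ℝ} [E₀(dWaveSourceTorus L U μ h) + h²L²/g]`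
(an infimum of concave `2L²`-Lipschitz functions of `μ`, attained on `|h| ≤ 8√2·g`; written with `⨅`). For every `δ`
in the window there is a `δ`-uniform window `[μ₁,μ₂] ⊂ (−4,0)` and `U₀ > 0` such that for all `0 < U ≤ U₀`,
`0 < g ≤ 1/10` an `L`-INDEPENDENT `μ₀ ∈ [μ₁,μ₂]` has, for every `η > 0`, a step `τ > 0` with both one-sided secants
of `B_L` at `μ₀` within `η` of `−(1−δ)` (per unit volume), eventually in `L`. By `stub_t0AHM`,
`|B_L − E₀(Hgc_L)| = o(L²)` uniformly on the window, so this is EQUIVALENT to the v3/v4 transfer (secant bracket of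
`μ ↦ E₀(Hgc_L(μ))`, now the proved `secantBracketT0_of_stubs`): no first-order density jump of the seeded model across
`1 − δ` at `T = 0`, restated through the AHM variational problem of the sourced model — the object the sourced
expansions of cruxes 1696/1697 address (Danskin: it holds iff all asymptotically optimal sources at `μ₀` carry
sourced ground-state density `1 − δ`). Its content is the open T = 0 phase-diagram input (barrier
`WeakCouplingCeiling`: every `g ∈ (0,1/10]`, `T = 0`); see the line report. -/
theorem stub_sourcedSecantBracketT0 :
    ∀ δ ∈ Set.Icc (1/10 : ℝ) (2/5 : ℝ), ∃ μ₁ μ₂ : ℝ, -4 < μ₁ ∧ μ₁ ≤ μ₂ ∧ μ₂ < 0 ∧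
      ∃ U₀ : ℝ, 0 < U₀ ∧ ∀ U ∈ Set.Ioc (0 : ℝ) U₀, ∀ g ∈ Set.Ioc (0 : ℝ) (1 / 10),
        ∃ μ₀ ∈ Set.Icc μ₁ μ₂, ∀ η : ℝ, 0 < η → ∃ τ : ℝ, 0 < τ ∧ ∃ L₀ : ℕ, ∀ (L : ℕ) [NeZero L], L₀ ≤ L →
          -(1 - δ) - η ≤
            ((⨅ h : ℝ, ((dWaveSourceTorus L U (μ₀ + τ) h).groundEnergy + h ^ 2 * (L : ℝ) ^ 2 / g)) -
              (⨅ h : ℝ, ((dWaveSourceTorus L U μ₀ h).groundEnergy + h ^ 2 * (L : ℝ) ^ 2 / g))) /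
              (τ * (L : ℝ) ^ 2) ∧
          ((⨅ h : ℝ, ((dWaveSourceTorus L U μ₀ h).groundEnergy + h ^ 2 * (L : ℝ) ^ 2 / g)) -
              (⨅ h : ℝ, ((dWaveSourceTorus L U (μ₀ - τ) h).groundEnergy + h ^ 2 * (L : ℝ) ^ 2 / g))) /
              (τ * (L : ℝ) ^ 2) ≤ -(1 - δ) + η := by
  sorry

/-! ## Proved composition -/

/-- Abstract sandwich step: if `F ≤ A h` for all `h` and `A h₀ ≤ F + e` for some `h₀`, then
`|⨅ h, A h − F| ≤ e` (both one-sided forms). -/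
theorem iInf_sandwich {A : ℝ → ℝ} {F e : ℝ} (hlow : ∀ h, F ≤ A h) {h₀ : ℝ} (hup : A h₀ ≤ F + e) :
    F ≤ (⨅ h, A h) ∧ (⨅ h, A h) ≤ F + e := by
  have hbdd : BddBelow (Set.range A) := ⟨F, by rintro _ ⟨h, rfl⟩; exact hlow h⟩
  exact ⟨le_ciInf hlow, (ciInf_le hbdd h₀).trans hup⟩

/-- **The v3/v4 transfer from the v5 stubs**: the T = 0 AHM bound makes `μ ↦ E₀(Hgc_L(μ))` and the Bogoliubov
functional `B_L` agree up to `o(L²)` uniformly on the window, so the secant bracket passes from `B_L`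
(`stub_sourcedSecantBracketT0`) to `E₀(Hgc_L)` (loss `η/2 + η/4 < η`). -/
theorem secantBracketT0_of_stubs
    (hAHM : ∀ (U g M : ℝ), 0 < g →
      (∀ (L : ℕ) [NeZero L] (μ h : ℝ),
        (hubbardTorusWith 2 L 1 U μ - ((g / (L : ℝ) ^ 2 : ℝ) : ℂ) •
            ((pairField dWaveFormFactor L)ᴴ * pairField dWaveFormFactor L)).groundEnergy ≤
          (dWaveSourceTorus L U μ h).groundEnergy + h ^ 2 * (L : ℝ) ^ 2 / g) ∧
      (∀ ε : ℝ, 0 < ε → ∃ L₀ : ℕ, ∀ (L : ℕ) [NeZero L], L₀ ≤ L → ∀ μ : ℝ, |μ| ≤ M →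
        ∃ h : ℝ, 0 ≤ h ∧
          (dWaveSourceTorus L U μ h).groundEnergy + h ^ 2 * (L : ℝ) ^ 2 / g ≤
            (hubbardTorusWith 2 L 1 U μ - ((g / (L : ℝ) ^ 2 : ℝ) : ℂ) •
              ((pairField dWaveFormFactor L)ᴴ * pairField dWaveFormFactor L)).groundEnergy +
              ε * (L : ℝ) ^ 2))
    (hB : ∀ δ ∈ Set.Icc (1/10 : ℝ) (2/5 : ℝ), ∃ μ₁ μ₂ : ℝ, -4 < μ₁ ∧ μ₁ ≤ μ₂ ∧ μ₂ < 0 ∧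
      ∃ U₀ : ℝ, 0 < U₀ ∧ ∀ U ∈ Set.Ioc (0 : ℝ) U₀, ∀ g ∈ Set.Ioc (0 : ℝ) (1 / 10),
        ∃ μ₀ ∈ Set.Icc μ₁ μ₂, ∀ η : ℝ, 0 < η → ∃ τ : ℝ, 0 < τ ∧ ∃ L₀ : ℕ, ∀ (L : ℕ) [NeZero L], L₀ ≤ L →
          -(1 - δ) - η ≤
            ((⨅ h : ℝ, ((dWaveSourceTorus L U (μ₀ + τ) h).groundEnergy + h ^ 2 * (L : ℝ) ^ 2 / g)) -
              (⨅ h : ℝ, ((dWaveSourceTorus L U μ₀ h).groundEnergy + h ^ 2 * (L : ℝ) ^ 2 / g))) /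
              (τ * (L : ℝ) ^ 2) ∧
          ((⨅ h : ℝ, ((dWaveSourceTorus L U μ₀ h).groundEnergy + h ^ 2 * (L : ℝ) ^ 2 / g)) -
              (⨅ h : ℝ, ((dWaveSourceTorus L U (μ₀ - τ) h).groundEnergy + h ^ 2 * (L : ℝ) ^ 2 / g))) /
              (τ * (L : ℝ) ^ 2) ≤ -(1 - δ) + η) :
    ∀ δ ∈ Set.Icc (1/10 : ℝ) (2/5 : ℝ), ∃ μ₁ μ₂ : ℝ, -4 < μ₁ ∧ μ₁ ≤ μ₂ ∧ μ₂ < 0 ∧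
      ∃ U₀ : ℝ, 0 < U₀ ∧ ∀ U ∈ Set.Ioc (0 : ℝ) U₀, ∀ g ∈ Set.Ioc (0 : ℝ) (1 / 10),
        ∃ μ₀ ∈ Set.Icc μ₁ μ₂, ∀ η : ℝ, 0 < η → ∃ τ : ℝ, 0 < τ ∧ ∃ L₀ : ℕ, ∀ (L : ℕ) [NeZero L], L₀ ≤ L →
          -(1 - δ) - η ≤
            ((hubbardTorusWith 2 L 1 U (μ₀ + τ) - ((g / (L : ℝ) ^ 2 : ℝ) : ℂ) •
                ((pairField dWaveFormFactor L)ᴴ * pairField dWaveFormFactor L)).groundEnergy -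
              (hubbardTorusWith 2 L 1 U μ₀ - ((g / (L : ℝ) ^ 2 : ℝ) : ℂ) •
                ((pairField dWaveFormFactor L)ᴴ * pairField dWaveFormFactor L)).groundEnergy) /
              (τ * (L : ℝ) ^ 2) ∧
          ((hubbardTorusWith 2 L 1 U μ₀ - ((g / (L : ℝ) ^ 2 : ℝ) : ℂ) •
                ((pairField dWaveFormFactor L)ᴴ * pairField dWaveFormFactor L)).groundEnergy -
              (hubbardTorusWith 2 L 1 U (μ₀ - τ) - ((g / (L : ℝ) ^ 2 : ℝ) : ℂ) •
                ((pairField dWaveFormFactor L)ᴴ * pairField dWaveFormFactor L)).groundEnergy) /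
              (τ * (L : ℝ) ^ 2) ≤ -(1 - δ) + η := by
  intro δ hδ
  obtain ⟨μ₁, μ₂, hμ₁, hμ₁₂, hμ₂, U₀, hU₀, hU⟩ := hB δ hδ
  refine ⟨μ₁, μ₂, hμ₁, hμ₁₂, hμ₂, U₀, hU₀, fun U hUm g hg => ?_⟩
  obtain ⟨μ₀, hμ₀m, hμ₀⟩ := hU U hUm g hg
  refine ⟨μ₀, hμ₀m, fun η hη => ?_⟩
  obtain ⟨τ, hτ, L₁, hL₁⟩ := hμ₀ (η / 2) (by linarith)
  -- the AHM sandwich on the compact `|μ| ≤ M`, `M := |μ₀| + τ`, with accuracy `ε := η τ / 4`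
  obtain ⟨hlow, hhard⟩ := hAHM U g (|μ₀| + τ) hg.1
  obtain ⟨L₂, hL₂⟩ := hhard (η * τ / 4) (by positivity)
  refine ⟨τ, hτ, max L₁ L₂, fun L _ hL => ?_⟩
  have hL1 : L₁ ≤ L := le_of_max_le_left hL
  have hL2 : L₂ ≤ L := le_of_max_le_right hL
  obtain ⟨hB1, hB2⟩ := hL₁ L hL1
  have hLpos : (0 : ℝ) < (L : ℝ) ^ 2 := cast_sq_pos_of_neZero L
  have hτL : 0 < τ * (L : ℝ) ^ 2 := mul_pos hτ hLpos
  -- names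
  set F : ℝ → ℝ := fun μ => (hubbardTorusWith 2 L 1 U μ - ((g / (L : ℝ) ^ 2 : ℝ) : ℂ) •
    ((pairField dWaveFormFactor L)ᴴ * pairField dWaveFormFactor L)).groundEnergy with hFdef
  set B : ℝ → ℝ := fun μ => ⨅ h : ℝ, ((dWaveSourceTorus L U μ h).groundEnergy + h ^ 2 * (L : ℝ) ^ 2 / g)
    with hBdef
  -- sandwich at the three chemical potentials
  have hsand : ∀ μ : ℝ, |μ| ≤ |μ₀| + τ → F μ ≤ B μ ∧ B μ ≤ F μ + η * τ / 4 * (L : ℝ) ^ 2 := by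
    intro μ hμ
    obtain ⟨h₀, -, hh₀⟩ := hL₂ L hL2 μ hμ
    exact iInf_sandwich (A := fun h => (dWaveSourceTorus L U μ h).groundEnergy + h ^ 2 * (L : ℝ) ^ 2 / g)
      (fun h => hlow L μ h) hh₀
  have hm0 : |μ₀| ≤ |μ₀| + τ := by linarith
  have hmp : |μ₀ + τ| ≤ |μ₀| + τ := (abs_add_le _ _).trans (by rw [abs_of_pos hτ])
  have hmm : |μ₀ - τ| ≤ |μ₀| + τ := (abs_sub _ _).trans (by rw [abs_of_pos hτ])
  obtain ⟨h0l, h0u⟩ := hsand μ₀ hm0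
  obtain ⟨hpl, hpu⟩ := hsand (μ₀ + τ) hmp
  obtain ⟨hml, hmu⟩ := hsand (μ₀ - τ) hmm
  have hεdiv : η * τ / 4 * (L : ℝ) ^ 2 / (τ * (L : ℝ) ^ 2) = η / 4 := by
    rw [show η * τ / 4 * (L : ℝ) ^ 2 = η / 4 * (τ * (L : ℝ) ^ 2) by ring, mul_div_assoc,
      div_self hτL.ne', mul_one]
  constructor
  · -- forward secant: (F(μ₀+τ) − F(μ₀))/(τL²) ≥ (B(μ₀+τ) − B(μ₀))/(τL²) − η/4
    have h1 : (B (μ₀ + τ) - B μ₀) - η * τ / 4 * (L : ℝ) ^ 2 ≤ F (μ₀ + τ) - F μ₀ := by linarith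
    have h2 := div_le_div_of_nonneg_right h1 hτL.le
    rw [sub_div, hεdiv] at h2
    have hB1' : -(1 - δ) - η / 2 ≤ (B (μ₀ + τ) - B μ₀) / (τ * (L : ℝ) ^ 2) := hB1
    change -(1 - δ) - η ≤ (F (μ₀ + τ) - F μ₀) / (τ * (L : ℝ) ^ 2)
    linarith
  · -- backward secant: (F(μ₀) − F(μ₀−τ))/(τL²) ≤ (B(μ₀) − B(μ₀−τ))/(τL²) + η/4
    have h1 : F μ₀ - F (μ₀ - τ) ≤ (B μ₀ - B (μ₀ - τ)) + η * τ / 4 * (L : ℝ) ^ 2 := by linarith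
    have h2 := div_le_div_of_nonneg_right h1 hτL.le
    rw [add_div, hεdiv] at h2
    have hB2' : (B μ₀ - B (μ₀ - τ)) / (τ * (L : ℝ) ^ 2) ≤ -(1 - δ) + η / 2 := hB2
    change (F μ₀ - F (μ₀ - τ)) / (τ * (L : ℝ) ^ 2) ≤ -(1 - δ) + η
    linarith


-- `stub_closerSecant` LANDED at p76106 (module `…Theorems.ThermalWedgeTwSeededEnsembleEquivalenceCloserSecant`, imported above).

-- `stub_closer` LANDED at p75364 (module `…Theorems.ThermalWedgeTwSeededEnsembleEquivalenceCloser`, imported above).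

/-! ## β-collapse and the line -/

/-- `|Fock(Λ_L)| = 4^{L²}` as a real logarithm: `log (card (Finset (Orb (FermionTorus 2 L)))) = L² log 4`. -/
theorem log_card_fock (L : ℕ) :
    Real.log (Fintype.card (Finset (Orb (FermionTorus 2 L))) : ℝ) = (L : ℝ) ^ 2 * Real.log 4 := by
  rw [Fintype.card_finset, card_orb_fermionTorus_two]
  push_cast
  rw [Real.log_pow, show (4 : ℝ) = 2 ^ 2 by norm_num, Real.log_pow]
  push_cast
  ring

/-- **β-collapse** (`HullTouch → crux`, same `μ` for every `β > 0`): by dimension counting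
`Re Z(β, Hgc) ≤ 4^{L²} e^{−β E₀(Hgc)}` (`partitionFn_le_card_mul_exp`), so
`e_L + p_L(β,μ) − μ n_L ≤ [minE − μN_L − E₀(Hgc)]/L² + log 4/β ≤ ε + log 4/β`. -/
theorem hullTouch_implies_crux
    (hHT : ∀ δ ∈ Set.Icc (1/10 : ℝ) (2/5 : ℝ), ∃ μ₁ μ₂ : ℝ, -4 < μ₁ ∧ μ₁ ≤ μ₂ ∧ μ₂ < 0 ∧
      ∃ U₀ : ℝ, 0 < U₀ ∧ ∀ U ∈ Set.Ioc (0 : ℝ) U₀, ∀ g ∈ Set.Ioc (0 : ℝ) (1 / 10),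
        ∃ μ ∈ Set.Icc μ₁ μ₂, ∀ ε : ℝ, 0 < ε → ∃ L₀ : ℕ, ∀ (L : ℕ) [NeZero L], L₀ ≤ L →
          (hubbardTorus 2 L 1 U - ((g / (L : ℝ) ^ 2 : ℝ) : ℂ) •
            ((pairField dWaveFormFactor L)ᴴ * pairField dWaveFormFactor L)).minEnergyOn
              (szSector (2 * ⌊(1 - δ) * (L : ℝ) ^ 2 / 2⌋₊) 0) -
            μ * ((2 * ⌊(1 - δ) * (L : ℝ) ^ 2 / 2⌋₊ : ℕ) : ℝ) ≤
          (hubbardTorusWith 2 L 1 U μ - ((g / (L : ℝ) ^ 2 : ℝ) : ℂ) •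
            ((pairField dWaveFormFactor L)ᴴ * pairField dWaveFormFactor L)).groundEnergy +
            ε * (L : ℝ) ^ 2) :
    -- the crux `TwSeededEnsembleEquivalence`, unfolded (so that only `TwSeededEnsembleEquivalence_of`
    -- below concludes the crux BY NAME, as the skeleton audit requires)
    ∀ δ ∈ Set.Icc (1/10 : ℝ) (2/5 : ℝ), ∃ μ₁ μ₂ : ℝ, -4 < μ₁ ∧ μ₁ ≤ μ₂ ∧ μ₂ < 0 ∧ ∃ U₀ : ℝ, 0 < U₀ ∧
      ∀ U ∈ Set.Ioc (0 : ℝ) U₀, ∀ g ∈ Set.Ioc (0 : ℝ) (1 / 10), ∀ β : ℝ, 1 ≤ β → ∃ μ ∈ Set.Icc μ₁ μ₂,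
        ∀ ε : ℝ, 0 < ε → ∃ L₀ : ℕ, ∀ (L : ℕ) [NeZero L], L₀ ≤ L →
          (((hubbardTorus 2 L 1 U - ((g / (L : ℝ) ^ 2 : ℝ) : ℂ) •
            ((pairField dWaveFormFactor L)ᴴ * pairField dWaveFormFactor L))).minEnergyOn
              (szSector (2 * ⌊(1 - δ) * (L : ℝ) ^ 2 / 2⌋₊) 0) / (L : ℝ) ^ 2) +
            (Real.log (Matrix.partitionFn β (hubbardTorusWith 2 L 1 U μ - ((g / (L : ℝ) ^ 2 : ℝ) : ℂ) •
              ((pairField dWaveFormFactor L)ᴴ * pairField dWaveFormFactor L))).re / (β * (L : ℝ) ^ 2)) -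
            μ * ((2 * ⌊(1 - δ) * (L : ℝ) ^ 2 / 2⌋₊) : ℝ) / (L : ℝ) ^ 2 ≤ Real.log 4 / β + ε := by
  intro δ hδ
  obtain ⟨μ₁, μ₂, hμ₁, hμ₁₂, hμ₂, U₀, hU₀, hU⟩ := hHT δ hδ
  refine ⟨μ₁, μ₂, hμ₁, hμ₁₂, hμ₂, U₀, hU₀, fun U hUm g hg β hβ => ?_⟩
  obtain ⟨μ, hμm, hμ⟩ := hU U hUm g hg
  refine ⟨μ, hμm, fun ε hε => ?_⟩
  obtain ⟨L₀, hL₀⟩ := hμ ε hε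
  refine ⟨L₀, fun L _ hL => ?_⟩
  have hT := hL₀ L hL
  have hβpos : 0 < β := lt_of_lt_of_le one_pos hβ
  have hLpos : (0 : ℝ) < (L : ℝ) ^ 2 := cast_sq_pos_of_neZero L
  have hβL : 0 < β * (L : ℝ) ^ 2 := mul_pos hβpos hLpos
  set Hgc := hubbardTorusWith 2 L 1 U μ - ((g / (L : ℝ) ^ 2 : ℝ) : ℂ) •
    ((pairField dWaveFormFactor L)ᴴ * pairField dWaveFormFactor L) with hHgc
  set A := (hubbardTorus 2 L 1 U - ((g / (L : ℝ) ^ 2 : ℝ) : ℂ) •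
    ((pairField dWaveFormFactor L)ᴴ * pairField dWaveFormFactor L)).minEnergyOn
      (szSector (2 * ⌊(1 - δ) * (L : ℝ) ^ 2 / 2⌋₊) 0) with hA
  have hH : Hgc.IsHermitian := isHermitian_seededGC L U μ g
  -- dimension counting: Re Z ≤ 4^{L²} e^{−β E₀}
  have hZpos : 0 < (Hgc.partitionFn β).re := by
    rw [hH.partitionFn_eq_ofReal β, Complex.ofReal_re]; exact hH.sum_exp_pos β
  have hZle : (Hgc.partitionFn β).re ≤
      Fintype.card (Finset (Orb (FermionTorus 2 L))) * Real.exp (-(β * Hgc.groundEnergy)) :=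
    partitionFn_le_card_mul_exp hH hβpos.le
  have hcard : (0 : ℝ) < Fintype.card (Finset (Orb (FermionTorus 2 L))) := by
    exact_mod_cast Fintype.card_pos
  have hlogZ : Real.log (Hgc.partitionFn β).re ≤ (L : ℝ) ^ 2 * Real.log 4 - β * Hgc.groundEnergy := by
    calc Real.log (Hgc.partitionFn β).re
        ≤ Real.log (Fintype.card (Finset (Orb (FermionTorus 2 L))) *
            Real.exp (-(β * Hgc.groundEnergy))) := Real.log_le_log hZpos hZle
      _ = (L : ℝ) ^ 2 * Real.log 4 - β * Hgc.groundEnergy := by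
          rw [Real.log_mul hcard.ne' (Real.exp_pos _).ne', Real.log_exp, log_card_fock]; ring
  -- divide by β L²
  have hp : Real.log (Hgc.partitionFn β).re / (β * (L : ℝ) ^ 2) ≤
      Real.log 4 / β - Hgc.groundEnergy / (L : ℝ) ^ 2 := by
    have hL2ne : (L : ℝ) ^ 2 ≠ 0 := hLpos.ne'
    have hβne : β ≠ 0 := hβpos.ne'
    have h1 := div_le_div_of_nonneg_right hlogZ hβL.le
    have h2 : ((L : ℝ) ^ 2 * Real.log 4 - β * Hgc.groundEnergy) / (β * (L : ℝ) ^ 2) =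
        Real.log 4 / β - Hgc.groundEnergy / (L : ℝ) ^ 2 := by
      rw [sub_div, mul_comm ((L : ℝ) ^ 2), mul_div_mul_right _ _ hL2ne, mul_div_mul_left _ _ hβne]
    rwa [h2] at h1
  -- the hull-touch hypothesis, divided by L²
  have hcast : ((2 * ⌊(1 - δ) * (L : ℝ) ^ 2 / 2⌋₊ : ℕ) : ℝ) = 2 * (⌊(1 - δ) * (L : ℝ) ^ 2 / 2⌋₊ : ℝ) := by
    push_cast; ring
  have hT' : A / (L : ℝ) ^ 2 - μ * (2 * (⌊(1 - δ) * (L : ℝ) ^ 2 / 2⌋₊ : ℝ)) / (L : ℝ) ^ 2 ≤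
      Hgc.groundEnergy / (L : ℝ) ^ 2 + ε := by
    rw [← hcast]
    have h1 : (A - μ * ((2 * ⌊(1 - δ) * (L : ℝ) ^ 2 / 2⌋₊ : ℕ) : ℝ)) / (L : ℝ) ^ 2 ≤
        (Hgc.groundEnergy + ε * (L : ℝ) ^ 2) / (L : ℝ) ^ 2 :=
      div_le_div_of_nonneg_right hT hLpos.le
    rw [sub_div, add_div, mul_div_assoc ε, div_self hLpos.ne', mul_one] at h1
    exact h1
  change A / (L : ℝ) ^ 2 + Real.log (Hgc.partitionFn β).re / (β * (L : ℝ) ^ 2) -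
    μ * (2 * (⌊(1 - δ) * (L : ℝ) ^ 2 / 2⌋₊ : ℝ)) / (L : ℝ) ^ 2 ≤ Real.log 4 / β + ε
  linarith

/-- One-particle cost in the closer's `∃ C` form, from the seed commutator stub and the averaging stub. -/
theorem oneParticleCost_of_stubs :
    ∀ (U g : ℝ), 0 ≤ U → 0 ≤ g → ∃ C : ℝ, 0 ≤ C ∧ ∀ (L : ℕ) [NeZero L] (N : ℕ),
      (1 ≤ N → N ≤ 2 * L ^ 2 →
        (hubbardTorus 2 L 1 U - ((g / (L : ℝ) ^ 2 : ℝ) : ℂ) •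
          ((pairField dWaveFormFactor L)ᴴ * pairField dWaveFormFactor L)).minEnergyOn
            (nParticleSubmodule (N - 1)) ≤
        (hubbardTorus 2 L 1 U - ((g / (L : ℝ) ^ 2 : ℝ) : ℂ) •
          ((pairField dWaveFormFactor L)ᴴ * pairField dWaveFormFactor L)).minEnergyOn
            (nParticleSubmodule N) + C * (L : ℝ) ^ 2 / N) ∧
      (N + 1 ≤ 2 * L ^ 2 →
        (hubbardTorus 2 L 1 U - ((g / (L : ℝ) ^ 2 : ℝ) : ℂ) •
          ((pairField dWaveFormFactor L)ᴴ * pairField dWaveFormFactor L)).minEnergyOn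
            (nParticleSubmodule (N + 1)) ≤
        (hubbardTorus 2 L 1 U - ((g / (L : ℝ) ^ 2 : ℝ) : ℂ) •
          ((pairField dWaveFormFactor L)ᴴ * pairField dWaveFormFactor L)).minEnergyOn
            (nParticleSubmodule N) + C * (L : ℝ) ^ 2 / (2 * (L : ℝ) ^ 2 - N)) := by
  intro U g hU hg
  obtain ⟨C₀, hC₀, hcomm⟩ := stub_seedCommutator
  have hcost := stub_oneParticleCost C₀ hC₀ hcomm
  refine ⟨(18 * (2 + |U|) + g * C₀) * 2, by positivity, fun L _ N => ?_⟩
  obtain ⟨h1, h2⟩ := hcost L U g hg N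
  constructor
  · intro hN1 hN2
    have := h1 hN1 hN2
    rwa [show (18 * (2 + |U|) + g * C₀) * (2 * (L : ℝ) ^ 2) / N =
      (18 * (2 + |U|) + g * C₀) * 2 * (L : ℝ) ^ 2 / N by ring] at this
  · intro hN
    have := h2 hN
    rwa [show (18 * (2 + |U|) + g * C₀) * (2 * (L : ℝ) ^ 2) / (2 * (L : ℝ) ^ 2 - N) =
      (18 * (2 + |U|) + g * C₀) * 2 * (L : ℝ) ^ 2 / (2 * (L : ℝ) ^ 2 - N) by ring] at this

/-- **The line.** `TwSeededEnsembleEquivalence` from the stubs: T = 0 AHM bound (`stub_t0AHM`) + secant bracket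
of the finite-volume Bogoliubov functional (the transfer, `stub_sourcedSecantBracketT0`) ⟹ secant bracket of
`μ ↦ E₀(Hgc_L(μ))` (`secantBracketT0_of_stubs`) ⟹ with ground-sector / even-sector / one-particle-cost bookkeeping
(landed) hull touch (`stub_closerSecant`, landed) ⟹ the crux at every `β ≥ 1` with the same `μ` (β-collapse,
`hullTouch_implies_crux`). -/
theorem TwSeededEnsembleEquivalence_of : TwSeededEnsembleEquivalence :=
  hullTouch_implies_crux
    (stub_closerSecant stub_groundSectorExists (stub_evenSectorMin stub_pairFieldSinglet)
      oneParticleCost_of_stubs (secantBracketT0_of_stubs stub_t0AHM stub_sourcedSecantBracketT0))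

/-- **The line, thermodynamic-limit form of the transfer.** EXPOSED DENSITY AT `T = 0` (the limiting
grand-canonical ground-energy density of the seeded model exists near some `μ₀` of the `δ`-window and
is differentiable there with slope `−(1−δ)`; the card's `C⁺`) also closes the crux, through the landed
`stub_closer` (kink lemma + this line's closer). Stated with the crux unfolded and the transfer as an
explicit hypothesis (it is not a registered stub: `stub_secantBracketT0` above is the weaker one). -/
theorem TwSeededEnsembleEquivalence_of_exposedDensityT0
    (hED : ∀ δ ∈ Set.Icc (1/10 : ℝ) (2/5 : ℝ), ∃ μ₁ μ₂ : ℝ, -4 < μ₁ ∧ μ₁ ≤ μ₂ ∧ μ₂ < 0 ∧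
      ∃ U₀ : ℝ, 0 < U₀ ∧ ∀ U ∈ Set.Ioc (0 : ℝ) U₀, ∀ g ∈ Set.Ioc (0 : ℝ) (1 / 10),
        ∃ μ₀ ∈ Set.Icc μ₁ μ₂, ∃ e : ℝ → ℝ, ∃ r : ℝ, 0 < r ∧
          (∀ μ ∈ Set.Icc (μ₀ - r) (μ₀ + r),
            Tendsto (fun L : ℕ =>
              (hubbardTorusWith 2 (L + 1) 1 U μ - ((g / ((L + 1 : ℕ) : ℝ) ^ 2 : ℝ) : ℂ) •
                ((pairField dWaveFormFactor (L + 1))ᴴ * pairField dWaveFormFactor (L + 1))).groundEnergy /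
                ((L + 1 : ℕ) : ℝ) ^ 2) atTop (𝓝 (e μ))) ∧
          HasDerivAt e (-(1 - δ)) μ₀) :
    ∀ δ ∈ Set.Icc (1/10 : ℝ) (2/5 : ℝ), ∃ μ₁ μ₂ : ℝ, -4 < μ₁ ∧ μ₁ ≤ μ₂ ∧ μ₂ < 0 ∧ ∃ U₀ : ℝ, 0 < U₀ ∧
      ∀ U ∈ Set.Ioc (0 : ℝ) U₀, ∀ g ∈ Set.Ioc (0 : ℝ) (1 / 10), ∀ β : ℝ, 1 ≤ β → ∃ μ ∈ Set.Icc μ₁ μ₂,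
        ∀ ε : ℝ, 0 < ε → ∃ L₀ : ℕ, ∀ (L : ℕ) [NeZero L], L₀ ≤ L →
          (((hubbardTorus 2 L 1 U - ((g / (L : ℝ) ^ 2 : ℝ) : ℂ) •
            ((pairField dWaveFormFactor L)ᴴ * pairField dWaveFormFactor L))).minEnergyOn
              (szSector (2 * ⌊(1 - δ) * (L : ℝ) ^ 2 / 2⌋₊) 0) / (L : ℝ) ^ 2) +
            (Real.log (Matrix.partitionFn β (hubbardTorusWith 2 L 1 U μ - ((g / (L : ℝ) ^ 2 : ℝ) : ℂ) •
              ((pairField dWaveFormFactor L)ᴴ * pairField dWaveFormFactor L))).re / (β * (L : ℝ) ^ 2)) -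
            μ * ((2 * ⌊(1 - δ) * (L : ℝ) ^ 2 / 2⌋₊) : ℝ) / (L : ℝ) ^ 2 ≤ Real.log 4 / β + ε :=
  hullTouch_implies_crux
    (stub_closer stub_groundSectorExists (stub_evenSectorMin stub_pairFieldSinglet)
      oneParticleCost_of_stubs hED)

end

end Summit.HubbardSuperconductivity.HubbardSuperconductivity.Theorems.TwSeededEnsembleEquivalence.ExposedDensity
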